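import Summits.ValiantsHypothesis.ValiantsHypothesis.Theorems.SymPencilPerFourColSixLever
import Summits.ValiantsHypothesis.ValiantsHypothesis.Theorems.SymPencilPerFourColSixForms
import Summits.ValiantsHypothesis.ValiantsHypothesis.Theorems.SymPencilAffineKernelLeverInvariance

/-!
# Route `SymPencil` — row `r = 10` of the size-`28` table: the threshold-shifted declarations of
# `SymPencilPerFourColSixLever` (`--supports` stmt-ValiantsHypothesis-5674 `SdcSuperquadratic`; rung currency only)

The declarations below (suffix `_m28`) are those of the landed `…Theorems.SymPencilPerFourColSixLever` whose meaning
changes when its numerical thresholds move by one unit — `Fin 6 → Fin 7` square families /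
`|ι'| ≤ 26 → ≤ 27` / `m ≤ 27 → m ≤ 28`, as applicable — with proofs VERBATIM; unchanged
declarations are used from the original module by name (same namespace).  Why it elaborates
(m = 28 table audit, val-lit-p6 g17, 2026-08-29; reader of record val-idea-crit-5 g4, probe P31):
the leaves of the `(10, 6)` chain are stated for `card ι < 8` / `< 9`, and every size lever reads
`4·rk bL ≤ 2·dim K + |ι'|` through integer division — one unit of slack throughout.  The `_m28`
statements imply the landed ones.

Honest framing: part of ONE row (cell `(10, 6, 7)`) of the size-`28` table; nothing about
`sdc(per_4)` follows here; `28 ≤ sdc(per_4) ≤ 29` of record, the crux `SdcSuperquadratic` and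
`VP ≠ VNP` untouched.  Credit: mathematics and proof text of `SymPencilPerFourColSixLever` (its authors); this file only
moves the bound.  No definitions, no named facts. [folklore]
-/

noncomputable section

-- single-conjunct layout: Sub = Summit, duplicated namespace component intended
set_option linter.dupNamespace false

namespace Summit.ValiantsHypothesis.ValiantsHypothesis.Theorems.SymPencilPerFourColSixLever

open Matrix MvPolynomial Module
open Literature.Computability.AlgebraicComplexity
open Summit.ValiantsHypothesis.ValiantsHypothesis.Theorems.SymPencilLagrangianKernel
open Summit.ValiantsHypothesis.ValiantsHypothesis.Theorems.SymPencilAffineKernelLever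
open Summit.ValiantsHypothesis.ValiantsHypothesis.Theorems.SymPencilAffineKernelLeverInvariance
open Summit.ValiantsHypothesis.ValiantsHypothesis.Theorems.SymPencilSdcPerFourTwentySeven
open Summit.ValiantsHypothesis.ValiantsHypothesis.Theorems.SymPencilPerFourCrossSixForms
open Summit.ValiantsHypothesis.ValiantsHypothesis.Theorems.SymPencilPerFourColSixForms
open Literature.Computability.AlgebraicComplexity.AlperBogartVelasco

universe u

variable {k : Type u} [Field k]

/-! ### The levers: the forms `P₀ₘ` vanish -/

variable [CharZero k] {ι' : Type*} [Fintype ι'] [DecidableEq ι']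

/-- **The `W_col` lever.**  In the base-point package with kernel space exactly `W_col`,
`|ι'| ≤ 27`, `dim (im bL) ≥ 10`, for each direction `d ∈ {a, b₁, b₂}`: the space
`K_d = im bL ⊓ (C(d)D⁻¹)⁻¹(im bL)` has dimension `≥ 7`, and both `K_d` and `C(d)D⁻¹ K_d` consist of
kernel rows of `Z8 = {x₂₀ = x₃₀ = 0}` (complement coordinates `x₀₀, x₁₀, x₂', x₃'`). [folklore] -/
theorem colW_lever_m28 {D : Matrix ι' ι' k} (hD : IsUnit D.det) (hDs : Dᵀ = D)
    (bL : (Fin 4 × Fin 4 → k) →ₗ[k] (ι' → k)) (CL : (Fin 4 × Fin 4 → k) →ₗ[k] Matrix ι' ι' k)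
    (hCs : ∀ z, (CL z)ᵀ = CL z) {κ : k} (hκ : κ ≠ 0)
    (hii : ∀ z, bL z ⬝ᵥ (D⁻¹ * CL z * D⁻¹) *ᵥ bL z = 0)
    (hN : ∀ v, bL v = 0 → IsUnit (D + CL v).det ∧ ∀ (z : Fin 4 × Fin 4 → k) (s : k),
      κ * MvPolynomial.eval (v + s • z) (perPoly (Fin 4) k) =
        (Matrix.fromBlocks ((s * 0) • (1 : Matrix Unit Unit k))
          (Matrix.replicateRow Unit (s • bL z)) (Matrix.replicateCol Unit (s • bL z))
          (D + CL v + s • CL z)).det)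
    (hker : ∀ x : Fin 4 × Fin 4 → k,
      bL x = 0 ↔ ∀ z : Fin 4 × Fin 4, ¬ ((z.1 = 0 ∨ z.1 = 1) ∧ z.2 ≠ 0) → x z = 0)
    (h10 : 10 ≤ finrank k (LinearMap.range bL)) (hcard : Fintype.card ι' ≤ 27)
    (d : Fin 4 × Fin 4 → k)
    (hd : d = (fun z : Fin 4 × Fin 4 =>
        (Matrix.of ![![0, 1, 1, 1], ![0, 0, 0, 0], ![0, 0, 0, 0], ![0, 0, 0, 0]]) z.1 z.2) ∨
      d = (fun z : Fin 4 × Fin 4 =>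
        (Matrix.of ![![0, 0, 0, 0], ![0, 1, 1, 1], ![0, 0, 0, 0], ![0, 0, 0, 0]]) z.1 z.2) ∨
      d = (fun z : Fin 4 × Fin 4 =>
        (Matrix.of ![![0, 0, 0, 0], ![0, 1, 1, 2], ![0, 0, 0, 0], ![0, 0, 0, 0]]) z.1 z.2)) :
    7 ≤ finrank k (LinearMap.range bL ⊓ (LinearMap.range bL).comap (CL d * D⁻¹).mulVecLin :
        Submodule k (ι' → k)) ∧
    ∀ y ∈ (LinearMap.range bL ⊓ (LinearMap.range bL).comap (CL d * D⁻¹).mulVecLin :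
        Submodule k (ι' → k)),
      (∃ (c : Fin 2 → k) (r : Fin 2 × Fin 3 → k), y = bL (fun z : Fin 4 × Fin 4 =>
        (Matrix.of ![![c 0, 0, 0, 0], ![c 1, 0, 0, 0], ![0, r (0, 0), r (0, 1), r (0, 2)],
          ![0, r (1, 0), r (1, 1), r (1, 2)]]) z.1 z.2)) ∧
      (∃ (c : Fin 2 → k) (r : Fin 2 × Fin 3 → k), CL d *ᵥ (D⁻¹ *ᵥ y) =
        bL (fun z : Fin 4 × Fin 4 =>
        (Matrix.of ![![c 0, 0, 0, 0], ![c 1, 0, 0, 0], ![0, r (0, 0), r (0, 1), r (0, 2)],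
          ![0, r (1, 0), r (1, 1), r (1, 2)]]) z.1 z.2)) := by
  classical
  -- the direction: one row, in the kernel, affine
  have hd_row : ∃ l : Fin 4, (l = 0 ∨ l = 1) ∧ ∀ (t : k) (i j : Fin 4), i ≠ l →
      (t • d) (i, j) = 0 := by
    rcases hd with rfl | rfl | rfl
    · refine ⟨0, Or.inl rfl, fun t i j hi => ?_⟩
      rw [Pi.smul_apply, smul_eq_mul]; fin_cases i
      · exact absurd rfl hi
      all_goals fin_cases j <;> simp
    all_goals
      refine ⟨1, Or.inr rfl, fun t i j hi => ?_⟩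
      rw [Pi.smul_apply, smul_eq_mul]; fin_cases i
      · fin_cases j <;> simp
      · exact absurd rfl hi
      all_goals fin_cases j <;> simp
  obtain ⟨l, hl, hrow⟩ := hd_row
  have hd_ker : ∀ t : k, bL (t • d) = 0 := by
    intro t
    refine (hker _).2 fun z hz => ?_
    obtain ⟨i, j⟩ := z
    by_cases hi : i = l
    · subst hi
      have hj : j = 0 := by
        by_contra hj; exact hz ⟨hl, hj⟩
      subst hj
      rw [Pi.smul_apply, smul_eq_mul]
      rcases hd with rfl | rfl | rfl <;> rcases hl with rfl | rfl <;> simp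
    · exact hrow t i j hi
  have haff : ∀ (t : k) (z : Fin 4 × Fin 4 → k), ∃ e₀ e₁ : k, ∀ s : k,
      MvPolynomial.eval (z + s • (t • d)) (perPoly (Fin 4) k) = e₀ + s * e₁ := fun t z =>
    affine_of_row k l (t • d) (hrow t) z
  set B := LinearMap.range bL with hBdef
  set N := (CL d * D⁻¹).mulVecLin with hNdef
  set K := (B ⊓ B.comap N : Submodule k (ι' → k)) with hKdef
  -- dimension
  have hK7 : 7 ≤ finrank k K := by
    have h := four_mul_finrank_le_finrank_K hD hDs bL CL hCs hκ hN d
      (by simpa using hd_ker 1) (fun z => by simpa using haff 1 z)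
    rw [← hBdef, ← hNdef, ← hKdef] at h
    omega
  refine ⟨hK7, ?_⟩
  -- the embedding of `Z8` and the projection onto the complement coordinates
  let embZ : ((Fin 2 → k) × (Fin 2 × Fin 3 → k)) →ₗ[k] (Fin 4 × Fin 4 → k) :=
    { toFun := fun x z => (Matrix.of ![![x.1 0, 0, 0, 0], ![x.1 1, 0, 0, 0],
        ![0, x.2 (0, 0), x.2 (0, 1), x.2 (0, 2)], ![0, x.2 (1, 0), x.2 (1, 1), x.2 (1, 2)]]) z.1 z.2
      map_add' := fun x y => by
        funext z; obtain ⟨i, j⟩ := z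
        fin_cases i <;> fin_cases j <;> simp
      map_smul' := fun c x => by
        funext z; obtain ⟨i, j⟩ := z
        fin_cases i <;> fin_cases j <;> simp }
  have hembZ : ∀ x, embZ x = fun z : Fin 4 × Fin 4 => (Matrix.of ![![x.1 0, 0, 0, 0],
      ![x.1 1, 0, 0, 0], ![0, x.2 (0, 0), x.2 (0, 1), x.2 (0, 2)],
      ![0, x.2 (1, 0), x.2 (1, 1), x.2 (1, 2)]]) z.1 z.2 := fun _ => rfl
  set B8 := LinearMap.range (bL ∘ₗ embZ) with hB8
  let π : (Fin 4 × Fin 4 → k) →ₗ[k] (Fin 4 × Fin 4 → k) :=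
    { toFun := fun x z => if (z.1 = 0 ∨ z.1 = 1) ∧ z.2 ≠ 0 then 0 else x z
      map_add' := fun x y => by
        funext z; simp only [Pi.add_apply]; split_ifs <;> simp
      map_smul' := fun c x => by
        funext z; simp only [Pi.smul_apply, smul_eq_mul, RingHom.id_apply]; split_ifs <;> simp }
  have hπ : ∀ x z, π x z = if (z.1 = 0 ∨ z.1 = 1) ∧ z.2 ≠ 0 then 0 else x z := fun _ _ => rfl
  have hπb : ∀ x, bL (π x) = bL x := by
    intro x
    have h : bL (π x - x) = 0 := (hker _).2 fun z hz => by
      rw [Pi.sub_apply, hπ, if_neg hz, sub_self]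
    rwa [map_sub, sub_eq_zero] at h
  have hπX : ∀ x, ∀ z : Fin 4 × Fin 4, (z.1 = 0 ∨ z.1 = 1) → z.2 ≠ 0 → π x z = 0 :=
    fun x z h1 h2 => by rw [hπ, if_pos ⟨h1, h2⟩]
  -- every lever space lies in `B8`
  have hT : ∀ t : k, (D + CL (t • d)) * D⁻¹ = (D + t • CL d) * D⁻¹ := fun t => by rw [map_smul]
  have hMle : ∀ t : k, t ≠ 0 → K.map ((D + t • CL d) * D⁻¹).mulVecLin ≤ B8 := by
    intro t ht
    set Tt := ((D + t • CL d) * D⁻¹).mulVecLin with hTt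
    set Mt := K.map Tt with hMt
    have hMeq : (B ⊓ B.map Tt : Submodule k (ι' → k)) = Mt := by
      rw [hMt, hKdef, hNdef, hTt]; exact lever_space_eq_map hD (CL d) B t ht
    set St := (Submodule.comap bL Mt).map π with hSt
    have hC : ∀ x ∈ St, ∀ m : Fin 3, x (2, 0) * x (3, m.succ) + x (2, m.succ) * x (3, 0) = 0 := by
      rintro _ ⟨x₀, hx₀, rfl⟩ m
      have hx₀' : bL x₀ ∈ (B ⊓ B.map Tt : Submodule k (ι' → k)) := by rw [hMeq]; exact hx₀
      obtain ⟨-, hx₀''⟩ := Submodule.mem_inf.1 hx₀'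
      obtain ⟨_, ⟨z₀, rfl⟩, hyz⟩ := Submodule.mem_map.1 hx₀''
      have hx : (D + CL (t • d))⁻¹ *ᵥ bL (π x₀) = D⁻¹ *ᵥ bL z₀ := by
        rw [hπb, ← hyz, hTt, Matrix.mulVecLin_apply, Matrix.mulVec_mulVec, ← Matrix.mul_assoc,
          map_smul, Matrix.nonsing_inv_mul _ (by rw [← map_smul]; exact (hN _ (hd_ker t)).1),
          Matrix.one_mul]
      exact colW_forms_vanish hDs bL CL hCs hκ hii hN hker d hd t ht (π x₀) z₀ hx m
    have hcols := cols_zero_of_isotropic St (by rintro _ ⟨x₀, -, rfl⟩ z h1 h2; exact hπX x₀ z h1 h2)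
      (fun m x hx x' hx' => by
        rw [← colW_form_polar, hC x hx m, hC x' hx' m, hC (x + x') (St.add_mem hx hx') m,
          sub_zero, sub_zero])
      (by
        have hMtle : Mt ≤ LinearMap.range bL := by rw [← hMeq]; exact inf_le_left
        have h1 : St.map bL = Mt := by
          rw [hSt, ← Submodule.map_comp, show bL ∘ₗ π = bL from LinearMap.ext hπb,
            Submodule.map_comap_eq, inf_eq_right.2 hMtle]
        have h2 := Submodule.finrank_map_le bL St
        rw [h1] at h2
        have htu : IsUnit (D + t • CL d).det := by
          rw [← map_smul]; exact (hN _ (hd_ker t)).1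
        have h3 : finrank k Mt = finrank k K :=
          (Submodule.equivMapOfInjective _ (translate_injective hD (CL d) t htu) K).finrank_eq.symm
        omega)
    intro y hy
    have hyB : y ∈ LinearMap.range bL := by
      have : y ∈ (B ⊓ B.map Tt : Submodule k (ι' → k)) := by rw [hMeq]; exact hy
      exact (Submodule.mem_inf.1 this).1
    obtain ⟨x₀, rfl⟩ := hyB
    have hx₀ : π x₀ ∈ St := ⟨x₀, hy, rfl⟩
    obtain ⟨h20, h30⟩ := hcols (π x₀) hx₀
    refine ⟨(![(π x₀) (0, 0), (π x₀) (1, 0)], fun p : Fin 2 × Fin 3 =>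
      (π x₀) ((![2, 3] : Fin 2 → Fin 4) p.1, p.2.succ)), ?_⟩
    rw [LinearMap.comp_apply, ← hπb x₀, hembZ]
    congr 1
    refine ((eq_colZ_of_cols (π x₀) (hπX x₀) h20 h30).trans ?_).symm
    rfl
  -- `t = 1, 2`
  intro y hy
  have mem : ∀ t : k, t ≠ 0 → y + t • N y ∈ B8 := fun t ht =>
    hMle t ht ⟨y, hy, by rw [translate_apply hD]⟩
  have e1 := mem 1 one_ne_zero
  have e2 := mem 2 two_ne_zero
  rw [one_smul] at e1
  rw [two_smul] at e2
  have hNy : N y ∈ B8 := by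
    have := B8.sub_mem e2 e1
    rwa [show y + (N y + N y) - (y + N y) = N y by abel] at this
  have hy8 : y ∈ B8 := by
    have := B8.sub_mem e1 hNy
    rwa [add_sub_cancel_right] at this
  refine ⟨?_, ?_⟩
  · obtain ⟨⟨c, r⟩, h⟩ := hy8
    exact ⟨c, r, by rw [← h, LinearMap.comp_apply, hembZ]⟩
  · obtain ⟨⟨c, r⟩, h⟩ := hNy
    refine ⟨c, r, ?_⟩
    rw [Matrix.mulVec_mulVec]
    have h' : N y = (CL d * D⁻¹) *ᵥ y := rfl
    rw [← h', ← h, LinearMap.comp_apply, hembZ]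
end Summit.ValiantsHypothesis.ValiantsHypothesis.Theorems.SymPencilPerFourColSixLever

end
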